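import Summits.SmoothPoincare4.SmoothPoincare4.Theses.WeylBudget

/-!
# Route WeylBudget — item `Assembly` (stmt-SmoothPoincare4-10833)

`Assembly : ChangGurskyYang → CorkRegluingBudget → BudgetTransfer → SmoothPoincare4`.

Proof: `BudgetTransfer` turns `CorkRegluingBudget` into `WeylLight`; for a smooth 4-manifold `M`
homotopy equivalent to `S⁴` the proved facts
`compactSpace_of_homotopyEquiv_sphere_four_holds`, `simplyConnectedSpace_sphere_four_holds`
(transported along the homotopy equivalence) and `isOrientable_of_homotopyEquiv_sphere_four_holds`
package `M` as a simply connected `HomotopySphere 4`; `WeylLight` supplies the Weyl-light metric of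
positive scalar curvature and `ChangGurskyYang` (Chang–Gursky–Yang 2003, Thm A) returns
`M ≃ₘ S⁴`. This is exactly the spine of the route's deciding theorem `closes`.
-/

-- the registered namespace `Summit.SmoothPoincare4.SmoothPoincare4.Theorems` repeats a component
set_option linter.dupNamespace false

namespace Summit.SmoothPoincare4.SmoothPoincare4.Theorems

open scoped Manifold ContDiff

open Summit.SmoothPoincare4.SmoothPoincare4.Theses.WeylBudget

/-- **Assembly of route WeylBudget** (item stmt-SmoothPoincare4-10833):
`ChangGurskyYang → CorkRegluingBudget → BudgetTransfer → SmoothPoincare4`.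
The budget transfer gives `WeylLight`; a smooth `M ≃ₕ S⁴` is compact, simply connected and
orientable (proved Literature facts), hence a `HomotopySphere 4`; `WeylLight` provides a metric of
positive scalar curvature with Weyl energy `< 32π²`, and the Chang–Gursky–Yang recognition
hypothesis yields `M ≃ₘ S⁴`. -/
theorem weylBudget_assembly_proof :
    Summit.SmoothPoincare4.SmoothPoincare4.Theses.WeylBudget.Assembly := by
  unfold Assembly
  intro hCGY hB hT
  have hW : WeylLight := hT hB
  unfold _root_.SmoothPoincare4 Literature.SPC4.SmoothPoincareConjectureFour
    ContinuousMap.HomotopyEquiv.NonemptyDiffeomorphSphere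
  intro M _ _ _ _ _ e
  haveI : CompactSpace M :=
    Literature.Topology.FourManifolds.compactSpace_of_homotopyEquiv_sphere_four_holds M e
  haveI : SimplyConnectedSpace (Metric.sphere (0 : EuclideanSpace ℝ (Fin 5)) 1) :=
    Literature.Topology.FourManifolds.simplyConnectedSpace_sphere_four_holds
  haveI : SimplyConnectedSpace M := e.simplyConnectedSpace
  obtain ⟨o⟩ :=
    Literature.Topology.FourManifolds.isOrientable_of_homotopyEquiv_sphere_four_holds M e
  obtain ⟨g, hLC, hg, hscal, hint⟩ :=
    hW { carrier := M, orientation := o, nonempty_homotopyEquiv := ⟨e⟩ }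
  exact hCGY M ⟨g, hLC, hg, hscal, hint⟩

end Summit.SmoothPoincare4.SmoothPoincare4.Theorems
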